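import Summits.Ventures.CertifiedManyBodySolver.Theorems.TcThermcert1SeamTwistCost
import Literature.MathematicalPhysics.QuantumLattice.BdGBondHamiltonianTorus
import Literature.MathematicalPhysics.QuantumLattice.HubbardTorusFluxGauge
import Literature.MathematicalPhysics.QuantumLattice.OnSitePairingAlgebra
import Literature.MathematicalPhysics.QuantumLattice.FermionOperatorsProofs
import Mathlib
import HarnessLib

/-!
# Stationarity of the half-torus charge: the seam current equals the far-cut current in every sector Gibbs state

Helper module for route `TcThermcert1`, cruxes K1′ `ThermalStiffnessCeilingU8b8_le_7o44` (item `stmt-Ventures-24560`)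
and K1 `ThermalStiffnessCeilingU8b10_le_1o8` (item `stmt-Ventures-26381`), line
`Cruxes/ThermalStiffnessCeilingU8b10_le_1o8/Lines/gauge_qbp_far_seam.lean`, stub A′ (`stub_seamCurrent_eq_farCutCurrent`).
On top of `Theorems/TcThermcert1SeamTwistCost.lean` (relocation by stationarity,
`gibbsState_toBlock_eq_of_smul_commutator_eq_sub`) this file supplies the Heisenberg identity it consumes:

* §1 CAR bookkeeping: `[c†_p c_q, n_a] = (δ_{aq} − δ_{ap}) c†_p c_q`, hence `[c†_p c_q, N_T] = (χ_T q − χ_T p) c†_p c_q` for the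
  particle number `N_T = Σ_{a ∈ T} n_a` of any orbital set `T`, and the bond form `[c†_p c_q + c†_q c_p, N_T] = (χ_T q − χ_T p)(c†_p c_q − c†_q c_p)`;
  `N_T` is diagonal in the occupation basis.
* §2 `ℤ/L` bookkeeping for the half torus `S = {0 ≤ x₁ < X}` (`1 ≤ X < L`): the difference of indicators
  `χ(x₁+1) − χ(x₁) = [x₁ = −1] − [x₁ = X − 1]`, and `![k, y] + e₁ = ![k + 1, y]`.
* §3 On the `t–U` flux torus `hubbardTorusTT'Flux L 0 U φ` (`L ≥ 3`): `i[hopping, N_S] =` (plain current through the cut `X`) `−`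
  (plain current through the cut `0`); `i[seamTwist L φ, N_S] =` (plain current through the cut `0`) `−` (phase-dressed seam current
  `∂_φ seamTwist`); the `U` term commutes; hence `i[H_L(φ), N_S] = J_X − ∂_φ seamTwist L φ`, and by relocation the compressed
  Gibbs expectation of `∂_φ seamTwist L φ` in ANY coordinate sector equals the sum over the `L` bonds of the antipodal cut
  `X = ⌊L/2⌋` of the plain bond currents (`gibbsState_fluxBlock_seamCurrent_eq_sum_farBond`) — stub A′ of the line with `L₀ = 3`.
No definitions (theorems only; the operators are written out as the explicit sums the line file names
`seamCurrentOp`, `bondCurrent`). All statements are finite-dimensional folklore (charge conservation / Kirchhoff);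
nothing about superconductivity in the Hubbard model is proved by anything in this file.
-/

noncomputable section

open scoped ComplexOrder ComplexConjugate
open Matrix Finset
open Literature.MathematicalPhysics.QuantumLattice
open Summit.Ventures.CertifiedManyBodySolver.Observables

namespace Summit.Ventures.CertifiedManyBodySolver.Theorems.TcThermcert1.GaugeQbpFarSeam

/-! ## §1 CAR bookkeeping: hopping monomials against number operators -/

section CAR

variable {ι : Type*} [LinearOrder ι] [Fintype ι]

/-- `[c†_p c_q, n_a] = (δ_{aq} − δ_{ap}) c†_p c_q` (all cases of coincidence included). [folklore] -/
theorem hop_mul_numberAt_sub (p q a : ι) :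
    creation p * annihilation q * numberAt a - numberAt a * (creation p * annihilation q) =
      ((if a = q then (1 : ℂ) else 0) - (if a = p then 1 else 0)) • (creation p * annihilation q) := by
  rcases eq_or_ne a p with rfl | hp
  · rcases eq_or_ne a q with rfl | hq
    · rw [if_pos rfl, sub_self, zero_smul]
      exact sub_eq_zero.2 rfl
    · have h1 : creation a * annihilation q * numberAt a = 0 := by
        rw [mul_assoc, ← numberAt_mul_annihilation_of_ne hq, ← mul_assoc,
          (show creation a * numberAt a = 0 from creation_mul_number_self a), zero_mul]
      have h2 : numberAt a * (creation a * annihilation q) = creation a * annihilation q := by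
        rw [← mul_assoc, (show numberAt a * creation a = creation a from number_mul_creation_self a)]
      rw [h1, h2, if_neg hq, if_pos rfl, zero_sub, zero_sub, neg_smul, one_smul]
  · rcases eq_or_ne a q with rfl | hq
    · have h1 : creation p * annihilation a * numberAt a = creation p * annihilation a := by
        rw [mul_assoc, annihilation_mul_numberAt_self]
      have h2 : numberAt a * (creation p * annihilation a) = 0 := by
        rw [← mul_assoc, (show numberAt a * creation p = creation p * numberAt a from number_mul_creation_of_ne hp),
          mul_assoc, numberAt_mul_annihilation_self, mul_zero]
      rw [h1, h2, if_pos rfl, if_neg hp, sub_zero, sub_zero, one_smul]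
    · have h : creation p * annihilation q * numberAt a = numberAt a * (creation p * annihilation q) := by
        rw [mul_assoc, ← numberAt_mul_annihilation_of_ne hq, ← mul_assoc,
          ← (show numberAt a * creation p = creation p * numberAt a from number_mul_creation_of_ne hp), mul_assoc]
      rw [h, sub_self, if_neg hp, if_neg hq, sub_self, zero_smul]

/-- `[c†_p c_q, N_T] = (χ_T(q) − χ_T(p)) c†_p c_q` for the particle number `N_T = Σ_{a ∈ T} n_a` of an orbital set `T`. [folklore] -/
theorem hop_mul_sumNumberAt_sub (p q : ι) (T : Finset ι) :
    creation p * annihilation q * (∑ a ∈ T, numberAt a) - (∑ a ∈ T, numberAt a) * (creation p * annihilation q) =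
      ((if q ∈ T then (1 : ℂ) else 0) - (if p ∈ T then 1 else 0)) • (creation p * annihilation q) := by
  rw [Finset.mul_sum, Finset.sum_mul, ← Finset.sum_sub_distrib,
    Finset.sum_congr rfl fun a _ => hop_mul_numberAt_sub p q a, ← Finset.sum_smul, Finset.sum_sub_distrib,
    Finset.sum_ite_eq' T q, Finset.sum_ite_eq' T p]

/-- Bond form: `[c†_p c_q + c†_q c_p, N_T] = (χ_T(q) − χ_T(p)) (c†_p c_q − c†_q c_p)`. [folklore] -/
theorem bond_mul_sumNumberAt_sub (p q : ι) (T : Finset ι) :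
    (creation p * annihilation q + creation q * annihilation p) * (∑ a ∈ T, numberAt a) -
        (∑ a ∈ T, numberAt a) * (creation p * annihilation q + creation q * annihilation p) =
      ((if q ∈ T then (1 : ℂ) else 0) - (if p ∈ T then 1 else 0)) •
        (creation p * annihilation q - creation q * annihilation p) := by
  rw [add_mul, mul_add, add_sub_add_comm, hop_mul_sumNumberAt_sub, hop_mul_sumNumberAt_sub]
  simp only [smul_sub, sub_smul]
  abel

/-- `N_T = Σ_{a ∈ T} n_a` is diagonal in the occupation basis: its off-diagonal entries vanish. [folklore] -/
theorem sumNumberAt_apply_of_ne (T : Finset ι) {s t : Finset ι} (h : s ≠ t) :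
    (∑ a ∈ T, numberAt a) s t = 0 := by
  rw [Matrix.sum_apply]
  refine Finset.sum_eq_zero fun a _ => ?_
  rw [numberAt_eq_diagonal, Matrix.diagonal_apply_ne _ h]

end CAR

section Commutators

variable {n : Type*} [Fintype n]

/-- Commutator with a finite sum, termwise. [folklore] -/
theorem sum_mul_sub_mul_sum {κ : Type*} (s : Finset κ) (M : κ → Matrix n n ℂ) (N : Matrix n n ℂ) :
    (∑ k ∈ s, M k) * N - N * (∑ k ∈ s, M k) = ∑ k ∈ s, (M k * N - N * M k) := by
  rw [Finset.sum_mul, Finset.mul_sum, Finset.sum_sub_distrib]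

/-- Commutator with a scalar multiple. [folklore] -/
theorem smul_mul_sub_mul_smul (c : ℂ) (M N : Matrix n n ℂ) :
    (c • M) * N - N * (c • M) = c • (M * N - N * M) := by
  rw [smul_mul_assoc, mul_smul_comm, smul_sub]

/-- Commutator of a sum of two operators. [folklore] -/
theorem add_mul_sub_mul_add (A B N : Matrix n n ℂ) :
    (A + B) * N - N * (A + B) = (A * N - N * A) + (B * N - N * B) := by
  rw [add_mul, mul_add, add_sub_add_comm]

end Commutators


/-! ## §2 `ℤ/L` bookkeeping for the half torus `{0 ≤ x₁ < X}` -/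

section ZModBookkeeping

open Literature.Probability.LatticeModels

variable {L : ℕ} [NeZero L]

/-- The canonical representative of `-1 : ℤ/L` is `L - 1`. [folklore] -/
theorem val_neg_one_add_one : (-1 : ZMod L).val + 1 = L :=
  (zmod_eq_neg_one_iff_val (-1 : ZMod L)).1 rfl

/-- **Difference of half-torus indicators along `e₁`** (`1 ≤ X < L`, `L ≥ 2`):
`χ(k+1) − χ(k) = [k = −1] − [k = X − 1]` for `χ(k) = [k.val < X]` — the only bonds `(k, k+1)` crossing the boundary of
`{0 ≤ x₁ < X}` are the seam bond `(−1, 0)` (inwards) and the far-cut bond `(X−1, X)` (outwards). [folklore] -/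
theorem indicator_val_add_one_sub (hL : 2 ≤ L) {X : ℕ} (hX1 : 1 ≤ X) (hXL : X < L) (k : ZMod L) :
    ((if (k + 1).val < X then (1 : ℂ) else 0) - (if k.val < X then 1 else 0)) =
      (if k = -1 then 1 else 0) - (if k = (X : ZMod L) - 1 then 1 else 0) := by
  have hXv : (X : ZMod L).val = X := ZMod.val_cast_of_lt hXL
  by_cases hk : k = -1
  · subst hk
    have hne : (-1 : ZMod L) ≠ (X : ZMod L) - 1 := by
      intro h
      have h' : (X : ZMod L) = 0 := by
        have := congrArg (· + 1) h
        simpa using this.symm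
      have : (X : ZMod L).val = 0 := by rw [h', ZMod.val_zero]
      omega
    rw [neg_add_cancel, ZMod.val_zero, if_pos (by omega), if_neg (by have := @val_neg_one_add_one L _; omega),
      if_pos rfl, if_neg hne]
  · have hv : (k + 1).val = k.val + 1 := zmod_val_add_one_of_ne_neg_one hL hk
    have hiff : k = (X : ZMod L) - 1 ↔ k.val + 1 = X := by
      constructor
      · intro h
        rw [← hv, h, sub_add_cancel, hXv]
      · intro h
        have h2 : k + 1 = (X : ZMod L) := ZMod.val_injective L (by rw [hv, h, hXv])
        rw [← h2, add_sub_cancel_right]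
    rw [hv, if_neg hk]
    by_cases hkX : k.val + 1 = X
    · rw [if_neg (by omega), if_pos (by omega), if_pos (hiff.2 hkX)]
    · rw [if_neg (fun h => hkX (hiff.1 h))]
      by_cases hlt : k.val < X
      · rw [if_pos (by omega), if_pos hlt, sub_self, sub_self]
      · rw [if_neg (by omega), if_neg hlt]

omit [NeZero L] in
/-- `![k, y] + e₁ = ![k + 1, y]` on the torus `(ℤ/L)²`. [folklore] -/
theorem vecCons_add_single_zero (k y : ZMod L) :
    ((![k, y] : TorusSite 2 L) + Pi.single (0 : Fin 2) 1 : TorusSite 2 L) = ![k + 1, y] := by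
  funext i
  fin_cases i <;> simp

omit [NeZero L] in
/-- `(x + e₁) 0 = x 0 + 1` on `(ℤ/L)²`. [folklore] -/
theorem add_single_zero_apply_zero (x : TorusSite 2 L) : (x + Pi.single (0 : Fin 2) 1 : TorusSite 2 L) 0 = x 0 + 1 := by
  simp

omit [NeZero L] in
/-- `(x + e₂) 0 = x 0` on `(ℤ/L)²`. [folklore] -/
theorem add_single_one_apply_zero (x : TorusSite 2 L) : (x + Pi.single (1 : Fin 2) 1 : TorusSite 2 L) 0 = x 0 := by
  simp

/-- Membership of a torus orbital in the half-torus orbital set `{a | a.site₁ < X}` is `x₁.val < X`. [folklore] -/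
theorem orb_ofTorusSite_mem_halfTorus (X : ℕ) (v : TorusSite 2 L) (σ : Fin 2) :
    orb (FermionTorus.ofTorusSite v) σ ∈
        (Finset.univ.filter fun a : Orb (FermionTorus 2 L) => ((ofLex (ofLex a).1) 0 : ℕ) < X) ↔
      (v 0).val < X := by
  rw [Finset.mem_filter]
  exact ⟨fun h => h.2, fun h => ⟨Finset.mem_univ _, h⟩⟩

end ZModBookkeeping

/-! ## §3 The Heisenberg identity `i[H_L(φ), N_S] = J_X − ∂_φ seamTwist` and the relocated Gibbs identity -/

section Torus

open Literature.Probability.LatticeModels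

variable (L : ℕ) [NeZero L]

/-- **`i[hopping, N_S]` on the torus** (`L ≥ 3`, `S = {0 ≤ x₁ < X}`, `1 ≤ X < L`): for the `t = 1` nearest-neighbour hopping
`Σ_{x,i,σ}(c†_{xσ}c_{x+eᵢ,σ} + h.c.)` and `N_S = Σ_{a ∈ T} n_a` with `T` the orbitals over `S`,
`[hop, N_S] = Σ_{y,σ} (c†_{(−1,y)} c_{(0,y)} − c†_{(0,y)} c_{(−1,y)}) − Σ_{y,σ} (c†_{(X−1,y)} c_{(X,y)} − c†_{(X,y)} c_{(X−1,y)})`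
(only the bonds crossing `∂S` survive; vertical bonds commute). [folklore] -/
theorem hopping_mul_halfNumber_sub (hL : 3 ≤ L) {X : ℕ} (hX1 : 1 ≤ X) (hXL : X < L)
    (T : Finset (Orb (FermionTorus 2 L)))
    (hT : ∀ (v : TorusSite 2 L) (σ : Fin 2), orb (FermionTorus.ofTorusSite v) σ ∈ T ↔ (v 0).val < X) :
    (∑ x : TorusSite 2 L, ∑ i : Fin 2, ∑ σ : Fin 2, (torusBondHop L x i σ + (torusBondHop L x i σ)ᴴ)) *
          (∑ a ∈ T, numberAt a) -
        (∑ a ∈ T, numberAt a) *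
          (∑ x : TorusSite 2 L, ∑ i : Fin 2, ∑ σ : Fin 2, (torusBondHop L x i σ + (torusBondHop L x i σ)ᴴ)) =
      (∑ y : ZMod L, ∑ σ : Fin 2,
          (creation (orb (FermionTorus.ofTorusSite ![-1, y]) σ) * annihilation (orb (FermionTorus.ofTorusSite ![0, y]) σ) -
            creation (orb (FermionTorus.ofTorusSite ![0, y]) σ) * annihilation (orb (FermionTorus.ofTorusSite ![-1, y]) σ))) -
        ∑ y : ZMod L, ∑ σ : Fin 2,
          (creation (orb (FermionTorus.ofTorusSite ![(X : ZMod L) - 1, y]) σ) *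
              annihilation (orb (FermionTorus.ofTorusSite ![(X : ZMod L), y]) σ) -
            creation (orb (FermionTorus.ofTorusSite ![(X : ZMod L), y]) σ) *
              annihilation (orb (FermionTorus.ofTorusSite ![(X : ZMod L) - 1, y]) σ)) := by
  have hL2 : 2 ≤ L := by omega
  -- push the commutator inside the sums and evaluate it bond by bond
  rw [sum_mul_sub_mul_sum]
  simp_rw [sum_mul_sub_mul_sum, torusBondHop_conjTranspose, torusBondHop_eq, bond_mul_sumNumberAt_sub, hT]
  -- the direction `i` outermost; vertical bonds (`i = 1`) commute with `N_S`
  rw [Finset.sum_comm, Fin.sum_univ_two]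
  simp only [add_single_one_apply_zero, add_single_zero_apply_zero, sub_self, zero_smul, Finset.sum_const_zero, add_zero]
  simp_rw [indicator_val_add_one_sub hL2 hX1 hXL, sub_smul, Finset.sum_sub_distrib, ite_smul, one_smul, zero_smul,
    Finset.sum_ite_irrel, Finset.sum_const_zero, sum_site_ite_apply_zero_eq, vecCons_add_single_zero, neg_add_cancel,
    sub_add_cancel]
  simp only [Finset.sum_sub_distrib]

omit [NeZero L] in
/-- **The on-site interaction commutes with every partial particle number** `N_T`. [folklore] -/
theorem interaction_commute_sumNumberAt (T : Finset (Orb (FermionTorus 2 L))) :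
    Commute (∑ x : FermionTorus 2 L, numberOp x 0 * numberOp x 1) (∑ a ∈ T, numberAt a) :=
  Commute.sum_left _ _ _ fun x _ => Commute.sum_right _ _ _ fun a _ =>
    Commute.mul_left (numberAt_commute (orb x 0) a) (numberAt_commute (orb x 1) a)

/-- **`i[hubbardTorus 2 L 1 U, N_S] = J_X − J_0`** (`L ≥ 3`, `1 ≤ X < L`): the plain two-spin bond currents
`Σ_{y,σ}(−i c†_{(X,y)σ} c_{(X−1,y)σ} + i c†_{(X−1,y)σ} c_{(X,y)σ})` through the cut `X` minus those through the cut `0`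
(Kirchhoff: the charge of `S = {0 ≤ x₁ < X}` changes only through its two boundary cuts). [folklore] -/
theorem I_smul_hubbardTorus_mul_halfNumber_sub (hL : 3 ≤ L) (U : ℝ) {X : ℕ} (hX1 : 1 ≤ X) (hXL : X < L)
    (T : Finset (Orb (FermionTorus 2 L)))
    (hT : ∀ (v : TorusSite 2 L) (σ : Fin 2), orb (FermionTorus.ofTorusSite v) σ ∈ T ↔ (v 0).val < X) :
    Complex.I • (hubbardTorus 2 L 1 U * (∑ a ∈ T, numberAt a) - (∑ a ∈ T, numberAt a) * hubbardTorus 2 L 1 U) =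
      (∑ y : ZMod L, ∑ σ : Fin 2,
          ((-Complex.I) • (creation (orb (FermionTorus.ofTorusSite ![(X : ZMod L), y]) σ) *
              annihilation (orb (FermionTorus.ofTorusSite ![(X : ZMod L) - 1, y]) σ)) +
            Complex.I • (creation (orb (FermionTorus.ofTorusSite ![(X : ZMod L) - 1, y]) σ) *
              annihilation (orb (FermionTorus.ofTorusSite ![(X : ZMod L), y]) σ)))) -
        ∑ y : ZMod L, ∑ σ : Fin 2,
          ((-Complex.I) • (creation (orb (FermionTorus.ofTorusSite ![0, y]) σ) *
              annihilation (orb (FermionTorus.ofTorusSite ![-1, y]) σ)) +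
            Complex.I • (creation (orb (FermionTorus.ofTorusSite ![-1, y]) σ) *
              annihilation (orb (FermionTorus.ofTorusSite ![0, y]) σ))) := by
  have hV := (interaction_commute_sumNumberAt L T).eq
  rw [hubbardTorus, hamiltonian, hubbard_hopping_torus_eq_sum_torusBondHop L hL, Complex.ofReal_one, add_mul, mul_add,
    smul_mul_assoc, smul_mul_assoc, mul_smul_comm, mul_smul_comm, hV, add_sub_add_right_eq_sub, ← smul_sub,
    hopping_mul_halfNumber_sub L hL hX1 hXL T hT, neg_smul, one_smul, neg_sub, smul_sub, Finset.smul_sum, Finset.smul_sum]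
  have hterm : ∀ P Q : Matrix (Finset (Orb (FermionTorus 2 L))) (Finset (Orb (FermionTorus 2 L))) ℂ,
      Complex.I • (P - Q) = (-Complex.I) • Q + Complex.I • P := fun P Q => by
    rw [smul_sub, neg_smul, sub_eq_neg_add]
  congr 1 <;>
  · refine Finset.sum_congr rfl fun y _ => ?_
    rw [Finset.smul_sum]
    exact Finset.sum_congr rfl fun σ _ => hterm _ _

/-- **`i[seamTwist L φ, N_S] = J_0 − ∂_φ seamTwist L φ`** (`1 ≤ X < L`): the seam twist `(1−e^{iφ}) c†_{(0,y)} c_{(−1,y)} + h.c.`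
against the charge of `S ∋ (0,y)`, `S ∌ (−1,y)`; `∂_φ seamTwist` is written as the explicit triple sum of
`hasDerivAt_seamTwist` (named `seamCurrentOp` in the line file). [folklore] -/
theorem I_smul_seamTwist_mul_halfNumber_sub (φ : ℝ) {X : ℕ} (hX1 : 1 ≤ X) (hXL : X < L)
    (T : Finset (Orb (FermionTorus 2 L)))
    (hT : ∀ (v : TorusSite 2 L) (σ : Fin 2), orb (FermionTorus.ofTorusSite v) σ ∈ T ↔ (v 0).val < X) :
    Complex.I • (seamTwist L φ * (∑ a ∈ T, numberAt a) - (∑ a ∈ T, numberAt a) * seamTwist L φ) =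
      (∑ y : ZMod L, ∑ σ : Fin 2,
          ((-Complex.I) • (creation (orb (FermionTorus.ofTorusSite ![0, y]) σ) *
              annihilation (orb (FermionTorus.ofTorusSite ![-1, y]) σ)) +
            Complex.I • (creation (orb (FermionTorus.ofTorusSite ![-1, y]) σ) *
              annihilation (orb (FermionTorus.ofTorusSite ![0, y]) σ)))) -
        ∑ y : ZMod L, ∑ σ : Fin 2, ∑ b : Bool,
          (-((if b then 1 else -1) * Complex.I) * Complex.exp ((if b then 1 else -1) * Complex.I * φ)) •
            (creation (orb (FermionTorus.ofTorusSite ![if b then 0 else -1, y]) σ) *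
              annihilation (orb (FermionTorus.ofTorusSite ![if b then -1 else 0, y]) σ)) := by
  have h0 : (0 : ZMod L).val < X := by rw [ZMod.val_zero]; omega
  have hm1 : ¬ (-1 : ZMod L).val < X := by have := @val_neg_one_add_one L _; omega
  rw [seamTwist_eq, sum_mul_sub_mul_sum]
  simp_rw [sum_mul_sub_mul_sum, smul_mul_sub_mul_smul, hop_mul_sumNumberAt_sub, hT]
  simp only [Fintype.sum_bool, if_true, Bool.false_eq_true, if_false, Matrix.cons_val_zero, if_pos h0, if_neg hm1]
  rw [Finset.smul_sum, ← Finset.sum_sub_distrib]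
  refine Finset.sum_congr rfl fun y _ => ?_
  rw [Finset.smul_sum, ← Finset.sum_sub_distrib]
  refine Finset.sum_congr rfl fun σ _ => ?_
  rw [smul_add, smul_smul, smul_smul, smul_smul, smul_smul, add_sub_add_comm, ← sub_smul, ← sub_smul]
  congr 1 <;> congr 1 <;> ring

/-- **The Heisenberg identity of the line:** `i[H_L(φ), N_S] = J_X − ∂_φ seamTwist L φ` for the `t–U` flux torus
`H_L(φ) = hubbardTorusTT'Flux L 0 U φ`, `S = {0 ≤ x₁ < X}`, `1 ≤ X < L`, `L ≥ 3` (hopping + seam + commuting `U` term; the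
cut-`0` currents cancel). [folklore] -/
theorem I_smul_fluxTorus_mul_halfNumber_sub (hL : 3 ≤ L) (U φ : ℝ) {X : ℕ} (hX1 : 1 ≤ X) (hXL : X < L)
    (T : Finset (Orb (FermionTorus 2 L)))
    (hT : ∀ (v : TorusSite 2 L) (σ : Fin 2), orb (FermionTorus.ofTorusSite v) σ ∈ T ↔ (v 0).val < X) :
    Complex.I • (hubbardTorusTT'Flux L 0 U φ * (∑ a ∈ T, numberAt a) - (∑ a ∈ T, numberAt a) * hubbardTorusTT'Flux L 0 U φ) =
      (∑ y : ZMod L, ∑ σ : Fin 2,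
          ((-Complex.I) • (creation (orb (FermionTorus.ofTorusSite ![(X : ZMod L), y]) σ) *
              annihilation (orb (FermionTorus.ofTorusSite ![(X : ZMod L) - 1, y]) σ)) +
            Complex.I • (creation (orb (FermionTorus.ofTorusSite ![(X : ZMod L) - 1, y]) σ) *
              annihilation (orb (FermionTorus.ofTorusSite ![(X : ZMod L), y]) σ)))) -
        ∑ y : ZMod L, ∑ σ : Fin 2, ∑ b : Bool,
          (-((if b then 1 else -1) * Complex.I) * Complex.exp ((if b then 1 else -1) * Complex.I * φ)) •
            (creation (orb (FermionTorus.ofTorusSite ![if b then 0 else -1, y]) σ) *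
              annihilation (orb (FermionTorus.ofTorusSite ![if b then -1 else 0, y]) σ)) := by
  rw [hubbardTorusTT'Flux_tPrime_zero, hubbardTorusFlux_eq, add_mul_sub_mul_add, smul_add,
    I_smul_hubbardTorus_mul_halfNumber_sub L hL U hX1 hXL T hT,
    I_smul_seamTwist_mul_halfNumber_sub L φ hX1 hXL T hT, sub_add_sub_cancel]

/-- **Stub A′ of line `gauge_qbp_far_seam` (relocated Gibbs identity, every coordinate sector, `L ≥ 3`).** In the
compressed Gibbs state of ANY coordinate sector `p` of the flux torus `hubbardTorusTT'Flux L 0 U φ`, the expectation of the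
phase-dressed seam current `∂_φ seamTwist L φ` equals the sum over the `L` bonds `y` of the antipodal cut `X = ⌊L/2⌋` of the
expectations of the plain two-spin bond currents `Σ_σ(−i c†_{(X,y)σ} c_{(X−1,y)σ} + i c†_{(X−1,y)σ} c_{(X,y)σ})`
(stationarity `⟨i[H, N_S]|_p⟩ = 0` of the half-torus charge, `N_S` diagonal, plus the Heisenberg identity). [folklore] -/
theorem gibbsState_fluxBlock_seamCurrent_eq_sum_farBond (hL : 3 ≤ L) (U β φ : ℝ)
    (p : Finset (Orb (FermionTorus 2 L)) → Prop) [DecidablePred p] :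
    gibbsState β ((hubbardTorusTT'Flux L 0 U φ).toBlock p p)
        ((∑ y : ZMod L, ∑ σ : Fin 2, ∑ b : Bool,
            (-((if b then 1 else -1) * Complex.I) * Complex.exp ((if b then 1 else -1) * Complex.I * φ)) •
              (creation (orb (FermionTorus.ofTorusSite ![if b then 0 else -1, y]) σ) *
                annihilation (orb (FermionTorus.ofTorusSite ![if b then -1 else 0, y]) σ))).toBlock p p) =
      ∑ y : ZMod L, gibbsState β ((hubbardTorusTT'Flux L 0 U φ).toBlock p p)
        ((∑ σ : Fin 2,
            ((-Complex.I) • (creation (orb (FermionTorus.ofTorusSite ![((L / 2 : ℕ) : ZMod L), y]) σ) *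
                annihilation (orb (FermionTorus.ofTorusSite ![((L / 2 : ℕ) : ZMod L) - 1, y]) σ)) +
              Complex.I • (creation (orb (FermionTorus.ofTorusSite ![((L / 2 : ℕ) : ZMod L) - 1, y]) σ) *
                annihilation (orb (FermionTorus.ofTorusSite ![((L / 2 : ℕ) : ZMod L), y]) σ)))).toBlock p p) := by
  have hX1 : 1 ≤ L / 2 := by omega
  have hXL : L / 2 < L := by omega
  have key := I_smul_fluxTorus_mul_halfNumber_sub L hL U φ hX1 hXL
    (Finset.univ.filter fun a : Orb (FermionTorus 2 L) => ((ofLex (ofLex a).1) 0 : ℕ) < L / 2)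
    (orb_ofTorusSite_mem_halfTorus (L / 2))
  have hN : ∀ s t, p s → ¬ p t →
      (∑ a ∈ (Finset.univ.filter fun a : Orb (FermionTorus 2 L) => ((ofLex (ofLex a).1) 0 : ℕ) < L / 2),
          numberAt a) s t = 0 ∧
        (∑ a ∈ (Finset.univ.filter fun a : Orb (FermionTorus 2 L) => ((ofLex (ofLex a).1) 0 : ℕ) < L / 2),
          numberAt a) t s = 0 := by
    intro s t hs ht
    have hst : s ≠ t := fun h => ht (h ▸ hs)
    exact ⟨sumNumberAt_apply_of_ne _ hst, sumNumberAt_apply_of_ne _ hst.symm⟩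
  rw [← gibbsState_toBlock_eq_of_smul_commutator_eq_sub p β _ Complex.I hN key, toBlock_sum, map_sum]

end Torus

end Summit.Ventures.CertifiedManyBodySolver.Theorems.TcThermcert1.GaugeQbpFarSeam
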